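import Mathlib
import HarnessLib
import Summits.HubbardSuperconductivity.HubbardSuperconductivity.Theorems.KLProgrammeKLRegimeEngineIsoLineFromPlainWt
import Summits.HubbardSuperconductivity.HubbardSuperconductivity.Theorems.KLProgrammeKLRegimeEngineWtLinesFlowDeepCut

/-!
# Route `KLProgramme` — ENGINE (stmt-HubbardSuperconductivity-20437 `KLRegimeEngineV17F2`), row (b): CURE (α) OF LOCATED #25 «(b)-PLAIN-UV-TAIL», LINK 2 —
# the `hexI` witness `IsoMomFlowAt` RE-KEYED to the UV-CUT plain line (pen (R669): cure of record (α), build authorised)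
# (cell gate-hubbard-kl, seat hubbard-kl-k3c2-p2 g33)

Verbatim twins of `…EngineIsoLineFromPlainWt` §2–§3 with the plain-line hypothesis on the leg-rescaled element `𝒱_cut := map (mulLeft ĝ) 𝒱ₙ[Kₙ]`,
`ĝ((k,σ),c) = gnScaleCutoff 4 klE0 1 |ω_k|`: the isotropic multipliers `klIsoFamily … m` (radial factor `C_{−m}⁻¹(√(ω²+e_K²))`, support `< klE0`) absorb the cut
(`klbv_klIsoFamily_mul_uvCut`), so the iso-sectorised kernels of `𝒱_cut` are those of `𝒱` (bridge ✓ p765436):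
* `klbv_klIsoFamily_mul_uvCut`; `isoFirstMomentsAt_of_wplainLine_isoSingle_cut`; **`isoMomFlowAt_of_wplainLine_isoSingle_cut`** (the re-keyed `hplainE1` binder's second consumer).
Everything is proved; no definitions; nothing asserts the cut plain line, row (b), any stub of 20437, K3 or superconductivity.
References: BGM 2006 §2.7 (2.70)–(2.71a), §2.8 (2.76)–(2.84), §3 (3.2)–(3.8) [cite: BenfattoGiulianiMastropietro2006].
-/

noncomputable section

namespace Summit.HubbardSuperconductivity.HubbardSuperconductivity.Theorems.EngineV8

set_option linter.dupNamespace false -- summit = problem name (single-conjunct summit), D-0017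

open Classical
open Real Finset Literature.MathematicalPhysics.QuantumLattice Literature.Probability.LatticeModels GrassmannAlgebra
open Literature.Probability.LatticeModels.BattleFederbush
open Literature.MathematicalPhysics.QuantumLattice.FermiRG
open Summit.HubbardSuperconductivity.HubbardSuperconductivity.Theorems.KLProgrammeLegKernels
open Summit.HubbardSuperconductivity.HubbardSuperconductivity.Theorems.KLRegimeSplit
open Summit.HubbardSuperconductivity.HubbardSuperconductivity.Theorems.TorusFourierL2
open Summit.HubbardSuperconductivity.HubbardSuperconductivity.Theorems.DispersionFlow

variable {L M : ℕ} [NeZero L] [NeZero M]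

/-! ## §0 The UV cut is absorbed by every isotropic sector family -/

omit [NeZero L] [NeZero M] in
/-- **Absorption (iso)**: `klIsoFamily … m σ k · C₁⁻¹(|ω_k|) = klIsoFamily … m σ k`. -/
theorem klbv_klIsoFamily_mul_uvCut (β μ : ℝ) (K : TrigPolyC4v) (m : ℕ) (σ : Fin (sectorCount (2 * m))) (k : FreqMomentum L M) :
    klIsoFamily L M β μ K klE0 m σ k * ((gnScaleCutoff 4 klE0 1 |matsubaraFreq β M k.1| : ℝ) : ℂ) = klIsoFamily L M β μ K klE0 m σ k := by
  refine klbv_absorb_of_eq_one_on_support (klIsoFamily L M β μ K klE0 m) (fun k => ((gnScaleCutoff 4 klE0 1 |matsubaraFreq β M k.1| : ℝ) : ℂ)) ?_ σ k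
  intro σ k hne
  have he : (0 : ℝ) < klE0 := by norm_num [klE0]
  have h4 : (1 : ℝ) < 4 := by norm_num
  have hrad : gnScaleCutoff 4 klE0 (-(m : ℤ)) (Real.sqrt (matsubaraFreq β M k.1 ^ 2 + nambuXiCT L μ K k.2 ^ 2)) ≠ 0 := by
    intro h0
    apply hne
    simp only [klIsoFamily, klIsoMultiplier, h0, zero_mul, Complex.ofReal_zero]
  have hlt : Real.sqrt (matsubaraFreq β M k.1 ^ 2 + nambuXiCT L μ K k.2 ^ 2) < klE0 * (4 : ℝ) ^ (-(m : ℤ)) := by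
    by_contra hge
    exact hrad (gnScaleCutoff_eq_zero h4 he (not_lt.mp hge))
  have hω : |matsubaraFreq β M k.1| ≤ Real.sqrt (matsubaraFreq β M k.1 ^ 2 + nambuXiCT L μ K k.2 ^ 2) := by
    rw [← Real.sqrt_sq_eq_abs]
    exact Real.sqrt_le_sqrt (by nlinarith [sq_nonneg (nambuXiCT L μ K k.2)])
  have hpow : (4 : ℝ) ^ (-(m : ℤ)) ≤ 1 := by
    rw [zpow_neg, zpow_natCast]
    exact inv_le_one_of_one_le₀ (one_le_pow₀ (by norm_num))
  have hle : |matsubaraFreq β M k.1| ≤ klE0 * (4 : ℝ) ^ ((1 : ℤ) - 1) := by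
    rw [sub_self, zpow_zero, mul_one]
    have := mul_le_mul_of_nonneg_left hpow he.le
    linarith
  rw [gnScaleCutoff_eq_one h4 he hle, Complex.ofReal_one]

/-! ## §1 `IsoFirstMomentsAt` / `IsoMomFlowAt` from the CUT plain line -/

/-- **`IsoFirstMomentsAt` FROM THE WEIGHTED PLAIN FOUR-LEG LINE AND THE WEIGHTED ISO SINGLE CHARACTER SUMS**: if the `klScaleWt_n`-weighted plain four-leg pinned sums of
`𝒱_n[K_n]` at leg `0` are `≤ N₁`, at every resolution `n ≤ m ≤ n_β` the weighted single character sums of `klIsoFamily … (K_n) klE0 m` at rate `Λ_m` are `≤ T m`, and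
`(T m/(βL²))⁴·ε⁴·N₁ ≤ cM·|U| + cM′·(P.Klam·U)²`, then `IsoFirstMomentsAt L M cM cM′ P β U μ n` (plateau pair (trivial, trivial ; iso m); rate `m ≥ n` is weaker,
`klScaleWt_le_of_le`). [cite: BenfattoGiulianiMastropietro2006, §2.7 (2.70)-(2.71a), §2.8 (2.76)-(2.84), §3 (3.5)-(3.6)] -/
theorem isoFirstMomentsAt_of_wplainLine_isoSingle_cut {β : ℝ} (hβ : 0 < β) (U μ : ℝ) (P : SplitConsts) (n : ℕ)
    {T : ℕ → ℝ} {N₁ : ℝ} (hT0 : ∀ m, 0 ≤ T m) (hN₁0 : 0 ≤ N₁) {cM cM' : ℝ}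
    (hT : ∀ m, n ≤ m → m ≤ nScales β → ∀ σ : Fin (sectorCount (2 * m)), ∑ z : TorusSite 1 (2 * M) × TorusSite 2 L,
      (1 + klScale klE0 m * β / (2 * M) * |(((z.1 0).valMinAbs : ℤ) : ℝ)| + klScale klE0 m * |(((z.2 0).valMinAbs : ℤ) : ℝ)| +
          klScale klE0 m * |(((z.2 1).valMinAbs : ℤ) : ℝ)|) *
      ‖∑ q : TorusSite 1 (2 * M) × TorusSite 2 L, (torusChar q.1 z.1 * torusChar q.2 z.2) •
        klIsoFamily L M β μ (klFlowFrameU L M β U μ n) klE0 m σ (⟨(q.1 0).val, ZMod.val_lt (q.1 0)⟩, q.2)‖ ≤ T m)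
    (hplain : ∀ (τ' : Fin 4 → SectorLeg 1) (y : SpaceTimeIdx L M),
      imagTimeWeight β M ^ 3 * ∑ x' ∈ univ.filter (fun x' : Fin 4 → SpaceTimeIdx L M => x' 0 = y),
        klScaleWt L M β n ((univ.image x').image (fun x : SpaceTimeIdx L M => (((((2 * (x.1 : ℕ) : ℕ)) : ZMod (2 * (2 * M)))), x.2))) *
          ‖sectorisedKernel L M β (trivialMultiplier L M)
            (ExteriorAlgebra.map (LinearMap.mulLeft ℂ (fun K : HubbardFieldIdx L M => ((gnScaleCutoff 4 klE0 1 |matsubaraFreq β M K.1.1.1| : ℝ) : ℂ)))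
              (klEffectiveAction L M β U μ (klFlowFrameU L M β U μ n) klE0 n)) 4 τ' x'‖ ≤ N₁)
    (hfit : ∀ m, n ≤ m → m ≤ nScales β →
      (T m / (β * (L : ℝ) ^ 2)) ^ 3 * (T m / (β * (L : ℝ) ^ 2)) * imagTimeWeight β M ^ 3 * (imagTimeWeight β M * N₁) ≤
        cM * |U| + cM' * (P.Klam * U) ^ 2) :
    IsoFirstMomentsAt L M cM cM' P β U μ n := by
  intro m hnm hm ω x₁ i
  have hL0 : (0 : ℝ) < L := Nat.cast_pos.2 (Nat.pos_of_ne_zero (NeZero.ne L))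
  have hε : 0 ≤ imagTimeWeight β M := imagTimeWeight_nonneg hβ.le M
  set K : TrigPolyC4v := klFlowFrameU L M β U μ n with hK
  set 𝒱 : HubbardGrassmann L M := klEffectiveAction L M β U μ K klE0 n with h𝒱
  set 𝒱c : HubbardGrassmann L M := ExteriorAlgebra.map (LinearMap.mulLeft ℂ (fun K : HubbardFieldIdx L M =>
    ((gnScaleCutoff 4 klE0 1 |matsubaraFreq β M K.1.1.1| : ℝ) : ℂ))) 𝒱 with h𝒱c
  set gpos : SpaceTimeIdx L M → ZMod (2 * (2 * M)) × TorusSite 2 L :=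
    fun x => (((((2 * (x.1 : ℕ) : ℕ)) : ZMod (2 * (2 * M)))), x.2) with hgpos
  have hc0 : 0 ≤ T m / (β * (L : ℝ) ^ 2) := div_nonneg (hT0 m) (by positivity)
  obtain ⟨hrowS, hcolS⟩ := transferSumsWt_klIso_single_le hβ μ K m m (hT m hnm hm)
  have hwt : IsTreeWeight (klScaleWt L M β m) := isTreeWeight_klScaleWt L M hβ.le m
  -- the plain line at the weaker rate `m ≥ n`
  have hplainm : ∀ (τ' : Fin 4 → SectorLeg 1) (y : SpaceTimeIdx L M),
      imagTimeWeight β M ^ 3 * ∑ x' ∈ univ.filter (fun x' : Fin 4 → SpaceTimeIdx L M => x' 0 = y),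
        klScaleWt L M β m ((univ.image x').image gpos) * ‖sectorisedKernel L M β (trivialMultiplier L M) 𝒱c 4 τ' x'‖ ≤ N₁ := by
    intro τ' y
    refine le_trans (mul_le_mul_of_nonneg_left (sum_le_sum fun x' _ => ?_) (pow_nonneg hε 3)) (hplain τ' y)
    exact mul_le_mul_of_nonneg_right (klScaleWt_le_of_le β hnm _) (norm_nonneg _)
  have hline := wprescribedSum_klIso_le_of_plain_treeWt hwt gpos hβ μ K m 𝒱c hc0 hc0 hN₁0
    (fun ω'' σ' c x' => hcolS ω'' σ' c x') (fun ω'' σ' c x'' => hrowS ω'' σ' c x'') 3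
    (fun k : Fin 4 => ((ω k, ![(0 : Fin 2), 0, 1, 1] k), ![(0 : Fin 2), 1, 0, 1] k)) 0 hplainm x₁
  simp_rw [h𝒱c, klbv_sectorisedKernel_map_mulLeft_of_absorb β _ _ (klbv_klIsoFamily_mul_uvCut β μ K m)] at hline
  refine ((klScale_mul_firstMoment_klIsoKernelAt_le_wtPinnedSum hβ.le U μ K n m m
    (fun k : Fin 4 => ((ω k, ![(0 : Fin 2), 0, 1, 1] k), ![(0 : Fin 2), 1, 0, 1] k)) x₁ i).trans (hline.trans (le_of_eq ?_))).trans (hfit m hnm hm)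
  ring


omit [NeZero L] [NeZero M] in
/-- **THE ISO-MOMENT WITNESS OF ROW (b) FROM `hplainE1` AND `hisoW` — BY TYPE**: `hplainE1` VERBATIM the E1 family of `e4FlowAt_of_wplainLine_flow_deep` (under `E4FlowAt`'s =
`IsoMomFlowAt`'s binders); `hisoW` = the weighted single character sums of the iso family `klIsoFamily … (K_n) klE0 m` at rate `Λ_m`, `≤ T_I·M·L²` for `n ≤ m ≤ n_β`, under the
same binders (`T_I` absolute).  Conclusion: `∃ Edu, 0 ≤ Edu.1 ∧ (∀ P R, 0 ≤ Edu.2.1 P R) ∧ (∀ G P R Q cc, 0 < Edu.2.2 G P R Q cc) ∧ IsoMomFlowAt Edu.1 Edu.2.1 Edu.2.2` — the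
type of `hexI` in `A24a1G14.stub_engine_step_norms_of_E1rows`. [cite: BenfattoGiulianiMastropietro2006, §2.7 (2.70)-(2.71a), §2.8 (2.76)-(2.84), §3 (3.2)-(3.8)] -/
theorem isoMomFlowAt_of_wplainLine_isoSingle_cut {a T_I : ℝ} (ha : 0 ≤ a) (hTI : 0 ≤ T_I)
    {bfun u₀ : GeoConsts → SplitConsts → RenConsts → EngConsts → ℝ → ℝ}
    (hb : ∀ G P R Q cc, 0 ≤ bfun G P R Q cc) (hu₀ : ∀ G P R Q cc, 0 < u₀ G P R Q cc)
    (hplain : ∀ (G : GeoConsts), G.WF → ∀ (P : SplitConsts) (R : RenConsts) (Q : EngConsts) (cc : ℝ), P.WF → R.WF2 → Q.WF → 0 < cc →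
      cc ≤ klEngC₃6 P R → ∀ μ ∈ klWindowC, ∀ U : ℝ, 0 < U → U ≤ u₀ G P R Q cc →
      ∀ β : ℝ, klBetaMin ≤ β → β ≤ Real.exp (cc / U ^ 2) →
      ∀ (L M : ℕ) [NeZero L] [NeZero M], klEngL₃ β U ≤ L → klEngM₃ β U L ≤ M →
      ∀ n : ℕ, 1 ≤ n → n ≤ nScales β + 1 → IsKLRegime U cc (-(n : ℤ)) →
        HistP klPredsV17F2 L M G P Q R β U μ 0 n → FrameOK R U (nScales β) μ (klFlowFrameU L M β U μ n) →
        ∀ (τ' : Fin 4 → SectorLeg 1) (y : SpaceTimeIdx L M),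
          imagTimeWeight β M ^ 3 * ∑ x' ∈ univ.filter (fun x' : Fin 4 → SpaceTimeIdx L M => x' 0 = y),
            klScaleWt L M β n ((univ.image x').image (fun x : SpaceTimeIdx L M => (((((2 * (x.1 : ℕ) : ℕ)) : ZMod (2 * (2 * M)))), x.2))) *
              ‖sectorisedKernel L M β (trivialMultiplier L M)
                (ExteriorAlgebra.map (LinearMap.mulLeft ℂ (fun K : HubbardFieldIdx L M => ((gnScaleCutoff 4 klE0 1 |matsubaraFreq β M K.1.1.1| : ℝ) : ℂ)))
              (klEffectiveAction L M β U μ (klFlowFrameU L M β U μ n) klE0 n)) 4 τ' x'‖ ≤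
          klE0 * (a * |U| + bfun G P R Q cc * (P.Klam * U) ^ 2))
    (hisoW : ∀ (G : GeoConsts), G.WF → ∀ (P : SplitConsts) (R : RenConsts) (Q : EngConsts) (cc : ℝ), P.WF → R.WF2 → Q.WF → 0 < cc →
      cc ≤ klEngC₃6 P R → ∀ μ ∈ klWindowC, ∀ U : ℝ, 0 < U → U ≤ u₀ G P R Q cc →
      ∀ β : ℝ, klBetaMin ≤ β → β ≤ Real.exp (cc / U ^ 2) →
      ∀ (L M : ℕ) [NeZero L] [NeZero M], klEngL₃ β U ≤ L → klEngM₃ β U L ≤ M →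
      ∀ n : ℕ, 1 ≤ n → n ≤ nScales β + 1 → IsKLRegime U cc (-(n : ℤ)) →
        HistP klPredsV17F2 L M G P Q R β U μ 0 n → FrameOK R U (nScales β) μ (klFlowFrameU L M β U μ n) →
        ∀ m, n ≤ m → m ≤ nScales β → ∀ σ : Fin (sectorCount (2 * m)),
          ∑ z : TorusSite 1 (2 * M) × TorusSite 2 L,
            (1 + klScale klE0 m * β / (2 * M) * |(((z.1 0).valMinAbs : ℤ) : ℝ)| + klScale klE0 m * |(((z.2 0).valMinAbs : ℤ) : ℝ)| +
                klScale klE0 m * |(((z.2 1).valMinAbs : ℤ) : ℝ)|) *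
            ‖∑ q : TorusSite 1 (2 * M) × TorusSite 2 L, (torusChar q.1 z.1 * torusChar q.2 z.2) •
              klIsoFamily L M β μ (klFlowFrameU L M β U μ n) klE0 m σ (⟨(q.1 0).val, ZMod.val_lt (q.1 0)⟩, q.2)‖ ≤ T_I * M * (L : ℝ) ^ 2) :
    ∃ Edu : ℝ × (SplitConsts → RenConsts → ℝ) × (GeoConsts → SplitConsts → RenConsts → EngConsts → ℝ → ℝ),
      0 ≤ Edu.1 ∧ (∀ P R, 0 ≤ Edu.2.1 P R) ∧ (∀ G P R Q cc, 0 < Edu.2.2 G P R Q cc) ∧ IsoMomFlowAt Edu.1 Edu.2.1 Edu.2.2 := by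
  have he : (0 : ℝ) < klE0 := by norm_num [klE0]
  set C : ℝ := (T_I / 2) ^ 4 * klE0 with hCdef
  have hC0 : 0 ≤ C := by positivity
  set u₁ : GeoConsts → SplitConsts → RenConsts → EngConsts → ℝ → ℝ :=
    fun G P R Q cc => min (u₀ G P R Q cc) (1 / (C * bfun G P R Q cc * P.Klam ^ 2 + 1)) with hu₁
  have hu₁pos : ∀ G P R Q cc, 0 < u₁ G P R Q cc := fun G P R Q cc => by
    have := hb G P R Q cc
    exact lt_min (hu₀ G P R Q cc) (by positivity)
  refine ⟨(C * a + 1, fun _ _ => 0, u₁), by positivity, fun _ _ => le_rfl, hu₁pos, ?_⟩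
  intro G hG P R Q cc hP hR hQ hcc hcc6 μ hμ U hU hUu β hβ hβc L M _ _ hL hM n hn1 hn hreg hhist hfr
  have hU0 : U ≤ u₀ G P R Q cc := hUu.trans (min_le_left _ _)
  have hUth : U ≤ 1 / (C * bfun G P R Q cc * P.Klam ^ 2 + 1) := hUu.trans (min_le_right _ _)
  have hβ0 : 0 < β := KLRegimeSplit.pos_of_klBetaMin_le hβ
  have hM0 : (0 : ℝ) < M := Nat.cast_pos.2 (Nat.pos_of_ne_zero (NeZero.ne M))
  have hL0 : (0 : ℝ) < L := Nat.cast_pos.2 (Nat.pos_of_ne_zero (NeZero.ne L))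
  have hN₁0 : 0 ≤ klE0 * (a * |U| + bfun G P R Q cc * (P.Klam * U) ^ 2) := by have := hb G P R Q cc; positivity
  refine isoFirstMomentsAt_of_wplainLine_isoSingle_cut hβ0 U μ P n (T := fun _ => T_I * M * (L : ℝ) ^ 2) (fun _ => by positivity) hN₁0
    (hisoW G hG P R Q cc hP hR hQ hcc hcc6 μ hμ U hU hU0 β hβ hβc L M hL hM n hn1 hn hreg hhist hfr)
    (hplain G hG P R Q cc hP hR hQ hcc hcc6 μ hμ U hU hU0 β hβ hβc L M hL hM n hn1 hn hreg hhist hfr) fun m _ _ => ?_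
  have hq : T_I * M * (L : ℝ) ^ 2 / (β * (L : ℝ) ^ 2) * imagTimeWeight β M = T_I / 2 := by
    unfold imagTimeWeight
    field_simp
  have hlhs : (T_I * M * (L : ℝ) ^ 2 / (β * (L : ℝ) ^ 2)) ^ 3 * (T_I * M * (L : ℝ) ^ 2 / (β * (L : ℝ) ^ 2)) * imagTimeWeight β M ^ 3 *
        (imagTimeWeight β M * (klE0 * (a * |U| + bfun G P R Q cc * (P.Klam * U) ^ 2))) =
      (T_I * M * (L : ℝ) ^ 2 / (β * (L : ℝ) ^ 2) * imagTimeWeight β M) ^ 4 * klE0 * (a * |U| + bfun G P R Q cc * (P.Klam * U) ^ 2) := by ring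
  rw [hlhs, hq]
  have hquad : C * bfun G P R Q cc * (P.Klam * U) ^ 2 ≤ |U| := mul_sq_le_abs_of_le_threshold hC0 (hb G P R Q cc) hU hUth
  calc (T_I / 2) ^ 4 * klE0 * (a * |U| + bfun G P R Q cc * (P.Klam * U) ^ 2)
      = C * a * |U| + C * bfun G P R Q cc * (P.Klam * U) ^ 2 := by rw [hCdef]; ring
    _ ≤ C * a * |U| + |U| := by linarith
    _ = (C * a + 1) * |U| + 0 * (P.Klam * U) ^ 2 := by ring

end Summit.HubbardSuperconductivity.HubbardSuperconductivity.Theorems.EngineV8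

end
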